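import Summits.BirchSwinnertonDyer.BirchSwinnertonDyer.Theorems.AdditiveKolyvaginRoadLevelStep
import Summits.BirchSwinnertonDyer.BirchSwinnertonDyer.Theorems.AdditiveKolyvaginRoadLevelBasics
import Summits.BirchSwinnertonDyer.BirchSwinnertonDyer.Theorems.KolyvaginRoadThreeZhangRankLowering
import Summits.BirchSwinnertonDyer.BirchSwinnertonDyer.Theses.AdditiveKolyvaginRoad
import HarnessLib

/-!
# Route `AdditiveKolyvaginRoad`, crux `KolyvaginPrimitiveAdditive` (item stmt-BirchSwinnertonDyer-20132):
# stub A1 `stub_rankLoweringAdditive` (skeleton v5) — (A1) RANK LOWERING for the p-GENERIC canonical spaces `SelQP`,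
# REDUCED to five local–global inputs at ONE Bertolini–Darmon admissible prime
# (cell `pub/bsd-wall`, lead prover `bsd-wall-akr-p1`; `--supports stmt-BirchSwinnertonDyer-20132`, helper;
# p-generic port of koly3a's `Theorems/KolyvaginRoadThreeMethod2RankLowering.lean` (p455830/p460669),
# proofs verbatim with `3 ↦ p` (odd), ordinary ↦ TORIC, unipotent-admissible ↦ BD-admissible, no «good level» needed)

The registered stub A1 of crux 20132 (skeleton v5, sha16 de262348) asks, at every ♯ additive frame, for complex
conjugation `c ≠ 1` and the `ZMod p`-structure of `H¹(K, E[p])`: every non-zero class of `SelQP n μ` (`n` a finite set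
of BD 1-admissible primes, data in `Theorems/AdditiveKolyvaginRoadLevelDefs.lean`, p508832) is killed at some NEW
admissible `q`, with `SelQP (n∪{q}) μ ≤ SelQP n μ` of codimension exactly one and `SelQP (n∪{q}) (−μ) = SelQP n (−μ)`
— W. Zhang 2014 Prop. 5.4 + Lemma 7.3 + (9.1)–(9.2). This file REDUCES it, in the kernel and uniformly in the odd prime
`p`, to five inputs at ONE admissible prime, each a printed statement at `p ≥ 5`:

* (Cheb) a non-zero class of `SelQP n μ` is detected by the localisation at some admissible `q ∉ n`
  [W. Zhang Lemma 7.3 ∕ BD05 Thm 3.2: Čebotarev in `K(E[p])/ℚ`, `ρ̄` onto, `p ≥ 5`];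
* (Equiv) complex conjugation acts on `H¹(K_q, E[p])` by a scalar sign, `loc_q` equivariantly [W. Zhang (9.2); at a
  BD-admissible `q` inert in `K`, `τ|_{K_q} = Frob_q` and the sign is `ε_q`];
* (Line) the localisations at `q` of the Kummer-at-`q` classes are multiples of one local class [BD05 Lemma 2.6:
  `H¹_fin(K_q, E[p])` is a line, from `p ∤ q² − 1`];
* (Trans) a multiple of a Kummer localisation that is TORIC vanishes [BD05 Lemma 2.6: `H¹_fin ∩ H¹_ord = 0`];
* (Iso) the localisations at `q` of two classes relaxed at `q` are proportional [Poitou–Tate see-saw, W. Zhang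
  Prop. 5.4: every local condition is Lagrangian — Kummer images by local Tate duality, at the additive `p` as
  everywhere, and the toric line at admissible primes].

THEOREMS: `torsionLocalKer_le_toricLocalKer`, `loc_eq_zero_of_sign_ne_odd` (the sign of a detecting prime is forced,
odd-torsion form), the unfoldings `conjAct_eq_of_mem_selQP` ∕ `mem_selmerLocalKer_of_mem_selQP` ∕
`mem_toricLocalKer_of_mem_selQP_insert`, the reduction `selQP_rankLowering_of_localGlobal` (conclusion = A1's (A1)-body
VERBATIM), and `stub_rankLoweringAdditive_of_localGlobal` — THE REGISTERED STUB SIGNATURE as conclusion, from the five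
inputs supplied frame-wise (CONDITIONAL; the prover of A1 discharges them: the `p = 3` analogues are koly g13's `Cheb.hcheb`,
zhang3-p1's `localEquiv_of_uAdmissible`, `localLine/localTrans_of_uAdmissible`, koly g13's `Iso.hiso`). The abstract
rank–nullity step is koly3a's `ZhangInduction.finrank_inf_ker_add_one_of_line` (imported; that module imports the
`KolyvaginRoadThree` route file — lint `theses-cone`, warning: the p-uniform linear algebra should move to a
route-independent module; not done here). HONEST FRAMING: structural; no definition, no named fact, no `sorry`;
nothing about the crux is asserted; the stub is NOT proved; nothing is booked.

References: [cite: WZhang2014, Prop. 5.4, Lemma 7.3, §9 (9.1)–(9.3)] [cite: BertoliniDarmon2005, Lemma 2.6, Thm. 3.2].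
-/

-- single-conjunct summit: `Summit.BirchSwinnertonDyer.BirchSwinnertonDyer.…` repeats the name by design
set_option linter.dupNamespace false

noncomputable section

open scoped Classical

namespace Summit.BirchSwinnertonDyer.BirchSwinnertonDyer.Theorems.AdditiveKoly

open WeierstrassCurve NumberField IsDedekindDomain
  Literature.NumberTheory.EllipticCurves Literature.NumberTheory.EllipticCurves.ModularForms
  Literature.NumberTheory.GaloisRepresentations Module

variable (W : WeierstrassCurve ℚ) (K : Type) [Field K] [NumberField K] (p : ℕ) (c : K ≃ₐ[ℚ] K)

/-! ## §0 Bookkeeping: zero classes are toric (the place lemmas are koly3a's, imported) -/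

/-- **A class with localisation ZERO at `v` satisfies the toric condition at `v`** (the zero class is represented by
the zero cocycle, which is valued in the augmentation line). [cite: BertoliniDarmon2005, §2.2] -/
theorem torsionLocalKer_le_toricLocalKer (E : Type) [Field E] [Algebra K E] (n : ℤ) :
    (W.baseChange K).torsionLocalKer E n ≤ toricLocalKer (W.baseChange K) E n := by
  intro x hx
  change (W.baseChange K).torsionLocMap E n x = 0 at hx
  change x ∈ AddSubgroup.comap _ _
  rw [AddSubgroup.mem_comap, hx]
  exact AddSubgroup.zero_mem _

/-! ## §1 The sign of a detecting prime is forced (Zhang (9.2), additive form) -/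

/-- **A localisation equivariant for complex conjugation with the WRONG sign vanishes** (odd torsion): if
`τ x = sgnP ν • x`, `loc (τ z) = sgnP s • loc z` for all `z`, `s ≠ ν` and `N • loc x = 0` for an ODD integer `N` (a class
of `H¹(K_v, E[p])`, `p` odd), then `loc x = 0` (`loc x = −loc x`, so `2 · loc x = 0`, and `N = 2k + 1`).
(p-generic form of koly3a's `Method2.loc_eq_zero_of_sign_ne`.) [cite: WZhang2014, §9 (9.2)] -/
theorem loc_eq_zero_of_sign_ne_odd {A B : Type*} [AddCommGroup A] [AddCommGroup B] (τ : A →+ A) (loc : A →+ B)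
    {s ν : Bool} (hequiv : ∀ z, loc (τ z) = sgnP s • loc z) {x : A} (hx : τ x = sgnP ν • x) (hne : s ≠ ν)
    {N : ℤ} (hN : Odd N) (hNx : N • loc x = 0) : loc x = 0 := by
  have h := hequiv x
  rw [hx, map_zsmul] at h
  -- in either case `loc x = - loc x`
  have hself : loc x = -loc x := by
    cases s <;> cases ν <;> simp only [sgnP, ite_true, ite_false, Bool.false_eq_true, neg_smul, one_smul] at h hne
    · exact absurd rfl hne
    · exact h
    · exact h.symm
    · exact absurd rfl hne
  have h2 : (2 : ℤ) • loc x = 0 := by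
    rw [two_zsmul]
    nth_rewrite 1 [hself]
    exact neg_add_cancel _
  obtain ⟨k, hk⟩ := hN
  have : N • loc x = loc x := by
    rw [hk, add_zsmul, one_zsmul, mul_comm, mul_zsmul, h2, zsmul_zero, zero_add]
  rw [← this, hNx]

/-! ## §2 Unfolding the canonical spaces at the place above a new admissible prime -/

section Unfold

variable [W.IsGloballyMinimal] [Module (ZMod p) (Vp W K p)]

/-- A class of `SelQ n ν` lies in the `sgn ν`-eigenspace of complex conjugation. [cite: WZhang2014, §5] -/
theorem conjAct_eq_of_mem_selQP (n : Finset (AdmQ W K p)) (ν : Bool) {y : Vp W K p}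
    (hy : y ∈ SelQP W K p c n ν) : conjAct W c ((p ^ 1 : ℕ) : ℤ) y = sgnP ν • y := by
  unfold SelQP at hy
  rw [AddSubgroup.mem_toZModSubmodule] at hy
  have h1 := (AddSubgroup.mem_inf.mp hy).1
  rw [AddMonoidHom.mem_ker, AddMonoidHom.sub_apply, sub_eq_zero] at h1
  exact h1

/-- **A level-`n` class is KUMMER above a unipotent-admissible `q ∉ n`** (the places above `q` lie above no prime
of `n`). [cite: WZhang2014, §5 (Sel_{𝔭_n})] -/
theorem mem_selmerLocalKer_of_mem_selQP (n : Finset (AdmQ W K p))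
    (q : AdmQ W K p) (hqn : q ∉ n) (v : HeightOneSpectrum (𝓞 K))
    (hv : ((q : ℕ) : 𝓞 K) ∈ v.asIdeal) (ν : Bool) {y : Vp W K p} (hy : y ∈ SelQP W K p c n ν) :
    y ∈ selmerLocalKer (W.baseChange K) (v.adicCompletion K) ((p ^ 1 : ℕ) : ℤ) := by
  unfold SelQP at hy
  rw [AddSubgroup.mem_toZModSubmodule] at hy
  have h3 := (AddSubgroup.mem_inf.mp (AddSubgroup.mem_inf.mp (AddSubgroup.mem_inf.mp hy).2).2).1
  rw [AddSubgroup.mem_iInf] at h3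
  have h3v := h3 v
  rw [AddSubgroup.mem_iInf] at h3v
  refine h3v fun q' hq' ↦ ?_
  have hdisj := disjoint_places_of_admQ W K p n ∅ q hqn (Set.notMem_empty _) v hv q'
  rw [Set.image_empty] at hdisj
  exact hdisj hq'

/-- **A level-`(n ∪ {q})` class is TORIC above `q`.** [cite: WZhang2014, §5 (Sel_{𝔭_n})] -/
theorem mem_toricLocalKer_of_mem_selQP_insert (n : Finset (AdmQ W K p))
    (q : AdmQ W K p) (v : HeightOneSpectrum (𝓞 K)) (hv : ((q : ℕ) : 𝓞 K) ∈ v.asIdeal)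
    (ν : Bool) {y : Vp W K p} (hy : y ∈ SelQP W K p c (insert q n) ν) :
    y ∈ toricLocalKer (W.baseChange K) (v.adicCompletion K) ((p ^ 1 : ℕ) : ℤ) := by
  unfold SelQP at hy
  rw [AddSubgroup.mem_toZModSubmodule] at hy
  have h4 := (AddSubgroup.mem_inf.mp (AddSubgroup.mem_inf.mp (AddSubgroup.mem_inf.mp hy).2).2).2
  rw [AddSubgroup.mem_iInf] at h4
  have h4q := h4 (q : ℕ)
  rw [AddSubgroup.mem_iInf] at h4q
  have h4q' := h4q ⟨Finset.mem_image_of_mem _ (Finset.mem_insert_self q n), Set.notMem_empty _⟩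
  rw [AddSubgroup.mem_iInf] at h4q'
  have h4v := h4q' v
  rw [AddSubgroup.mem_iInf] at h4v
  exact h4v hv

end Unfold

/-! ## §3 The (A1) conjunct of `stub_levelRaisingAtThree` from the five local–global inputs -/

section RankLowering

variable [W.IsElliptic] [W.IsGloballyMinimal] [Fact p.Prime] [Module (ZMod p) (Vp W K p)]

/-- **RANK LOWERING for the canonical spaces `SelQ` from (Cheb) + (Equiv) + (Line) + (Trans) + (Iso).** The
conclusion is VERBATIM the (A1) conjunct of the registered stub `stub_levelRaisingAtThree` (v2t): every non-zero
class `x ∈ SelQ n μ` is killed at some new unipotent-admissible `q`, with `SelQ (n∪{q}) μ ≤ SelQ n μ` of codimension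
exactly one and `SelQ (n∪{q}) (−μ) = SelQ n (−μ)`. Inputs (module docstring): (Cheb) a non-zero class of `SelQ n μ`
is detected by the localisation at some unipotent-admissible `q ∉ n` [Zhang Lemma 7.3 ∕ BD05 Thm 3.2 ∕ koly U3];
(Equiv) complex conjugation acts on `H¹(K_q, E[3])` by a scalar sign and `loc_q` is equivariant [Zhang (9.2)];
(Line) the localisations of the Kummer-at-`q` classes are multiples of one local class [BD05 L.2.6 ∕ koly U1];
(Trans) a multiple of a Kummer localisation which is toric vanishes [BD05 L.2.6 ∕ koly U4]; (Iso) the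
localisations at `q` of two classes relaxed at `q` are proportional [Poitou–Tate; Zhang Prop 5.4]. Proof: the sign of
`q` is forced to be `μ` (`loc_eq_zero_of_sign_ne` at `x`), so `loc_q` kills every `−μ`-eigenclass; the one-prime step
`selQ_insert_inf_kummer_eq` (zhang3-p1) + (Iso) + (Trans) give `SelQ (n∪{q}) μ = SelQ n μ ⊓ ker loc_q` and, with the
vanishing on the `−μ`-side, `SelQ (n∪{q}) (−μ) = SelQ n (−μ)`; rank–nullity against the line (Line)
(`ZhangInduction.finrank_inf_ker_add_one_of_line`) gives codimension one. CONDITIONAL on the five binders; nothing is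
booked. [cite: WZhang2014, Prop. 5.4, Lemma 7.3, §9 (9.1)–(9.3)] [cite: BertoliniDarmon2005, Lemma 2.6, Thm. 3.2] -/
theorem selQP_rankLowering_of_localGlobal (hp : Odd p)
    -- (Cheb) Čebotarev with the sign rule
    (hcheb : ∀ (n : Finset (AdmQ W K p)) (μ : Bool) (x : Vp W K p), x ∈ SelQP W K p c n μ → x ≠ 0 →
      ∃ q : AdmQ W K p, q ∉ n ∧ ∃ v : HeightOneSpectrum (𝓞 K),
        ((q : ℕ) : 𝓞 K) ∈ v.asIdeal ∧ (W.baseChange K).torsionLocMap (v.adicCompletion K) ((p ^ 1 : ℕ) : ℤ) x ≠ 0)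
    -- (Equiv) complex conjugation acts on H¹(K_q, E[3]) by the scalar sign of q, equivariantly
    (hequiv : ∀ q : AdmQ W K p, ∃ s : Bool, ∀ v : HeightOneSpectrum (𝓞 K),
      ((q : ℕ) : 𝓞 K) ∈ v.asIdeal → ∀ z : Vp W K p,
        (W.baseChange K).torsionLocMap (v.adicCompletion K) ((p ^ 1 : ℕ) : ℤ) (conjAct W c ((p ^ 1 : ℕ) : ℤ) z) =
          sgnP s • (W.baseChange K).torsionLocMap (v.adicCompletion K) ((p ^ 1 : ℕ) : ℤ) z)
    -- (Line) the Kummer image at q is a line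
    (hline : ∀ (q : AdmQ W K p) (v : HeightOneSpectrum (𝓞 K)), ((q : ℕ) : 𝓞 K) ∈ v.asIdeal →
      ∃ ℓ, ∀ y ∈ selmerLocalKer (W.baseChange K) (v.adicCompletion K) ((p ^ 1 : ℕ) : ℤ),
        ∃ a : ℤ, (W.baseChange K).torsionLocMap (v.adicCompletion K) ((p ^ 1 : ℕ) : ℤ) y = a • ℓ)
    -- (Trans) Kummer ∩ toric = 0 at q
    (htrans : ∀ (q : AdmQ W K p) (v : HeightOneSpectrum (𝓞 K)), ((q : ℕ) : 𝓞 K) ∈ v.asIdeal →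
      ∀ y z : Vp W K p, y ∈ selmerLocalKer (W.baseChange K) (v.adicCompletion K) ((p ^ 1 : ℕ) : ℤ) →
        z ∈ toricLocalKer (W.baseChange K) (v.adicCompletion K) ((p ^ 1 : ℕ) : ℤ) →
        (∃ a : ℤ, (W.baseChange K).torsionLocMap (v.adicCompletion K) ((p ^ 1 : ℕ) : ℤ) z =
          a • (W.baseChange K).torsionLocMap (v.adicCompletion K) ((p ^ 1 : ℕ) : ℤ) y) →
        (W.baseChange K).torsionLocMap (v.adicCompletion K) ((p ^ 1 : ℕ) : ℤ) z = 0)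
    -- (Iso) Poitou–Tate isotropy of the image of the space relaxed at q
    (hiso : ∀ (n : Finset (AdmQ W K p)) (q : AdmQ W K p) (μ : Bool),
      q ∉ n → ∀ v : HeightOneSpectrum (𝓞 K), ((q : ℕ) : 𝓞 K) ∈ v.asIdeal →
      ∀ y ∈ SelRelQP W K p c (insert q n) {q} μ, ∀ z ∈ SelRelQP W K p c (insert q n) {q} μ,
        (W.baseChange K).torsionLocMap (v.adicCompletion K) ((p ^ 1 : ℕ) : ℤ) z ≠ 0 →
        ∃ a : ℤ, (W.baseChange K).torsionLocMap (v.adicCompletion K) ((p ^ 1 : ℕ) : ℤ) y =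
          a • (W.baseChange K).torsionLocMap (v.adicCompletion K) ((p ^ 1 : ℕ) : ℤ) z) :
    ∀ (n : Finset (AdmQ W K p)) (μ : Bool) (x : Vp W K p),
      x ∈ SelQP W K p c n μ → x ≠ 0 →
      ∃ q : AdmQ W K p, q ∉ n ∧ x ∉ SelQP W K p c (insert q n) μ ∧
        SelQP W K p c (insert q n) μ ≤ SelQP W K p c n μ ∧
        finrank (ZMod p) (SelQP W K p c (insert q n) μ) + 1 = finrank (ZMod p) (SelQP W K p c n μ) ∧
        SelQP W K p c (insert q n) (!μ) = SelQP W K p c n (!μ) := by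
  intro n μ x hx hx0
  obtain ⟨q, hqn, v, hv, hvx⟩ := hcheb n μ x hx hx0
  set loc := (W.baseChange K).torsionLocMap (v.adicCompletion K) ((p ^ 1 : ℕ) : ℤ) with hloc
  -- the place above the inert prime q is unique
  have hq0 : (q : ℕ) ≠ 0 := q.2.1.ne_zero
  have hqP : (Ideal.span {((q : ℕ) : 𝓞 K)}).IsPrime := q.2.2.2.1
  have huniq : ∀ v' : HeightOneSpectrum (𝓞 K), ((q : ℕ) : 𝓞 K) ∈ v'.asIdeal → v' = v := by
    -- an inert prime has exactly one place above it (a non-zero prime of a Dedekind domain is maximal)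
    have hspan : ∀ w : HeightOneSpectrum (𝓞 K), ((q : ℕ) : 𝓞 K) ∈ w.asIdeal →
        w.asIdeal = Ideal.span {((q : ℕ) : 𝓞 K)} := fun w hw ↦ by
      have hle : Ideal.span {((q : ℕ) : 𝓞 K)} ≤ w.asIdeal := by
        rw [Ideal.span_le, Set.singleton_subset_iff]
        exact hw
      have hne : Ideal.span {((q : ℕ) : 𝓞 K)} ≠ ⊥ := by
        rw [Ne, Ideal.span_singleton_eq_bot]
        exact_mod_cast hq0
      exact ((hqP.isMaximal hne).eq_of_le w.isPrime.ne_top hle).symm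
    intro v' hv'
    exact HeightOneSpectrum.ext (by rw [hspan v hv, hspan v' hv'])
  -- local classes are p-torsion, `p` odd
  have hNloc : ∀ z : Vp W K p, ((p ^ 1 : ℕ) : ℤ) • loc z = 0 := fun z ↦
    zsmul_discreteH1_torsion ((p ^ 1 : ℕ) : ℤ) (loc z)
  have hNodd : Odd (((p ^ 1 : ℕ) : ℤ)) := by
    rw [pow_one]
    exact_mod_cast hp
  -- the sign of q is forced to be μ
  obtain ⟨s, hs⟩ := hequiv q
  have hsv : ∀ z : Vp W K p, loc (conjAct W c ((p ^ 1 : ℕ) : ℤ) z) = sgnP s • loc z := hs v hv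
  have hsμ : s = μ := by
    by_contra hne
    exact hvx (loc_eq_zero_of_sign_ne_odd (conjAct W c _) loc hsv (conjAct_eq_of_mem_selQP W K p c n μ hx) hne hNodd
      (hNloc x))
  -- hence loc_q kills every (−μ)-eigenclass
  have hkill : ∀ (m : Finset (AdmQ W K p)) (y : Vp W K p), y ∈ SelQP W K p c m (!μ) → loc y = 0 :=
    fun m y hy ↦ loc_eq_zero_of_sign_ne_odd (conjAct W c _) loc hsv (conjAct_eq_of_mem_selQP W K p c m (!μ) hy)
      (by rw [hsμ]; cases μ <;> decide) hNodd (hNloc y)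
  -- zero classes are Kummer and toric
  have hKumTor : ∀ y : Vp W K p, loc y = 0 →
      y ∈ selmerLocalKer (W.baseChange K) (v.adicCompletion K) ((p ^ 1 : ℕ) : ℤ) := fun y hy ↦
    (W.baseChange K).torsionLocalKer_le_selmerLocalKer (v.adicCompletion K) _ (AddMonoidHom.mem_ker.mpr hy)
  have hOrdTor : ∀ y : Vp W K p, loc y = 0 →
      y ∈ toricLocalKer (W.baseChange K) (v.adicCompletion K) ((p ^ 1 : ℕ) : ℤ) := fun y hy ↦
    torsionLocalKer_le_toricLocalKer W K _ _ (AddMonoidHom.mem_ker.mpr hy)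
  -- the one-prime step (zhang3-p1), in membership form at the unique place v
  have hstep : ∀ (ν : Bool) (y : Vp W K p),
      (y ∈ SelQP W K p c (insert q n) ν ∧ y ∈ selmerLocalKer (W.baseChange K) (v.adicCompletion K) ((p ^ 1 : ℕ) : ℤ)) ↔
      (y ∈ SelQP W K p c n ν ∧ y ∈ toricLocalKer (W.baseChange K) (v.adicCompletion K) ((p ^ 1 : ℕ) : ℤ)) := by
    intro ν y
    have h' := SetLike.ext_iff.mp (selQP_insert_inf_kummer_eq W K p c n q hqn ν) y
    simp only [Submodule.mem_inf, AddSubgroup.mem_toZModSubmodule, AddSubgroup.mem_iInf] at h'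
    constructor
    · rintro ⟨h1, h2⟩
      obtain ⟨h1', h2'⟩ := h'.mp ⟨h1, fun v' hv' ↦ by rw [huniq v' hv']; exact h2⟩
      exact ⟨h1', h2' v hv⟩
    · rintro ⟨h1, h2⟩
      obtain ⟨h1', h2'⟩ := h'.mpr ⟨h1, fun v' hv' ↦ by rw [huniq v' hv']; exact h2⟩
      exact ⟨h1', h2' v hv⟩
  -- the KERNEL DESCRIPTION (Zhang Prop 5.4) on the μ-side
  have hker : ∀ y : Vp W K p, y ∈ SelQP W K p c (insert q n) μ ↔ (y ∈ SelQP W K p c n μ ∧ loc y = 0) := by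
    intro y
    constructor
    · intro hy
      have hmono := selRelQP_mono W K p c (insert q n)
        (S := (∅ : Set (AdmQ W K p))) (S' := {q}) (Set.empty_subset _) μ
      rw [← selQP_eq_selRelQP_empty] at hmono
      have hyR : y ∈ SelRelQP W K p c (insert q n) {q} μ := hmono hy
      have hxR : x ∈ SelRelQP W K p c (insert q n) {q} μ := relaxationP_le W K p c n q {q} μ hqn (Set.mem_singleton q) hx
      have hy0 : loc y = 0 :=
        htrans q v hv x y (mem_selmerLocalKer_of_mem_selQP W K p c n q hqn v hv μ hx)
          (mem_toricLocalKer_of_mem_selQP_insert W K p c n q v hv μ hy) (hiso n q μ hqn v hv y hyR x hxR hvx)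
      exact ⟨((hstep μ y).mp ⟨hy, hKumTor y hy0⟩).1, hy0⟩
    · rintro ⟨hy, hy0⟩
      exact ((hstep μ y).mpr ⟨hy, hOrdTor y hy0⟩).1
  -- codimension exactly one: rank–nullity against the line (Line), over ZMod p
  -- (`haveI`, not `letI`: with a variable `p` the let-bound instance body blocks the `FunLike` coercion of `locZ`)
  haveI : Module (ZMod p) (discreteH1 (Field.absoluteGaloisGroup (v.adicCompletion K))
      (AddSubgroup.torsionBy (localPoints (W.baseChange K) (v.adicCompletion K)) ((p ^ 1 : ℕ) : ℤ))) :=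
    AddCommGroup.zmodModule (fun z ↦ by
      have h := zsmul_discreteH1_torsion ((p ^ 1 : ℕ) : ℤ) z
      rw [← natCast_zsmul]
      convert h using 2
      push_cast
      ring)
  set locZ := loc.toZModLinearMap p with hlocZ
  have hlocZ_apply : ∀ y : Vp W K p, locZ y = loc y := fun _ ↦ rfl
  obtain ⟨ℓ, hℓ⟩ := hline q v hv
  haveI : FiniteDimensional (ZMod p) (SelQP W K p c n μ) := finiteDimensional_selQP W K p c n μ
  haveI : FiniteDimensional (ZMod p) (Submodule.span (ZMod p) ({ℓ} : Set _)) :=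
    FiniteDimensional.span_of_finite (ZMod p) (Set.finite_singleton ℓ)
  have hfr : finrank (ZMod p) ↥(SelQP W K p c n μ ⊓ LinearMap.ker locZ) + 1 = finrank (ZMod p) (SelQP W K p c n μ) := by
    refine Summit.BirchSwinnertonDyer.Rank1Residual.X11b.Three.Koly.ZhangInduction.finrank_inf_ker_add_one_of_line (SelQP W K p c n μ) locZ (Submodule.span (ZMod p) {ℓ})
      ((finrank_span_le_card _).trans (le_of_eq (by rw [Set.toFinset_card, Set.card_singleton]))) ?_
      ⟨x, hx, by rw [hlocZ_apply]; exact hvx⟩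
    intro y hy
    obtain ⟨a, ha⟩ := hℓ y (mem_selmerLocalKer_of_mem_selQP W K p c n q hqn v hv μ hy)
    rw [Submodule.mem_span_singleton]
    exact ⟨(a : ZMod p), by rw [hlocZ_apply, ha, Int.cast_smul_eq_zsmul]⟩
  have heq : SelQP W K p c (insert q n) μ = SelQP W K p c n μ ⊓ LinearMap.ker locZ := by
    ext y
    rw [Submodule.mem_inf, LinearMap.mem_ker, hlocZ_apply]
    exact hker y
  refine ⟨q, hqn, fun hxq ↦ hvx ((hker x).mp hxq).2, fun y hy ↦ ((hker y).mp hy).1, by rw [heq]; exact hfr, ?_⟩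
  -- the (−μ)-side is untouched
  ext y
  constructor
  · intro hy
    exact ((hstep (!μ) y).mp ⟨hy, hKumTor y (hkill _ y hy)⟩).1
  · intro hy
    exact ((hstep (!μ) y).mpr ⟨hy, hOrdTor y (hkill _ y hy)⟩).1

end RankLowering

/-! ## §4 The registered stub signature from the inputs, frame-wise (CONDITIONAL; the prover of A1 discharges them) -/

section Stub

open Literature.NumberTheory.EllipticCurves.ModularForms Literature.NumberTheory.EllipticCurves.Rank1Residual

/-- **`stub_rankLoweringAdditive` (skeleton v5 of crux 20132) FROM THE FIVE LOCAL–GLOBAL INPUTS, frame-wise** — the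
registered signature VERBATIM as conclusion. At each ♯ additive frame and each `c ≠ 1`, GIVEN (Cheb), (Equiv), (Line),
(Trans), (Iso) for that `(E, K, p, c)` (binder `hLG`), the (A1) rank lowering holds (`selQP_rankLowering_of_localGlobal`;
`p` is odd since `5 ≤ p`). CONDITIONAL on `hLG`; the stub is proved once `hLG` is discharged (E-side: Čebotarev with
`ρ̄` onto, the local picture at a BD-admissible prime, Poitou–Tate). [cite: WZhang2014, Prop. 5.4, Lemma 7.3]
[cite: BertoliniDarmon2005, Lemma 2.6, Thm. 3.2] -/
theorem stub_rankLoweringAdditive_of_localGlobal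
    (hLG : ∀ (W : WeierstrassCurve ℚ) [W.IsElliptic] [W.IsGloballyMinimal] (p : ℕ) [Fact p.Prime]
      (K : Type) [Field K] [NumberField K] (c : K ≃ₐ[ℚ] K) [Module (ZMod p) (Vp W K p)],
      5 ≤ p → W.HasSurjectiveModNGaloisRep p → IsImaginaryQuadratic K → c ≠ 1 →
      -- (Cheb)
      (∀ (n : Finset (AdmQ W K p)) (μ : Bool) (x : Vp W K p), x ∈ SelQP W K p c n μ → x ≠ 0 →
        ∃ q : AdmQ W K p, q ∉ n ∧ ∃ v : HeightOneSpectrum (𝓞 K),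
          ((q : ℕ) : 𝓞 K) ∈ v.asIdeal ∧ (W.baseChange K).torsionLocMap (v.adicCompletion K) ((p ^ 1 : ℕ) : ℤ) x ≠ 0) ∧
      -- (Equiv)
      (∀ q : AdmQ W K p, ∃ s : Bool, ∀ v : HeightOneSpectrum (𝓞 K),
        ((q : ℕ) : 𝓞 K) ∈ v.asIdeal → ∀ z : Vp W K p,
          (W.baseChange K).torsionLocMap (v.adicCompletion K) ((p ^ 1 : ℕ) : ℤ) (conjAct W c ((p ^ 1 : ℕ) : ℤ) z) =
            sgnP s • (W.baseChange K).torsionLocMap (v.adicCompletion K) ((p ^ 1 : ℕ) : ℤ) z) ∧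
      -- (Line)
      (∀ (q : AdmQ W K p) (v : HeightOneSpectrum (𝓞 K)), ((q : ℕ) : 𝓞 K) ∈ v.asIdeal →
        ∃ ℓ, ∀ y ∈ selmerLocalKer (W.baseChange K) (v.adicCompletion K) ((p ^ 1 : ℕ) : ℤ),
          ∃ a : ℤ, (W.baseChange K).torsionLocMap (v.adicCompletion K) ((p ^ 1 : ℕ) : ℤ) y = a • ℓ) ∧
      -- (Trans)
      (∀ (q : AdmQ W K p) (v : HeightOneSpectrum (𝓞 K)), ((q : ℕ) : 𝓞 K) ∈ v.asIdeal →
        ∀ y z : Vp W K p, y ∈ selmerLocalKer (W.baseChange K) (v.adicCompletion K) ((p ^ 1 : ℕ) : ℤ) →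
          z ∈ toricLocalKer (W.baseChange K) (v.adicCompletion K) ((p ^ 1 : ℕ) : ℤ) →
          (∃ a : ℤ, (W.baseChange K).torsionLocMap (v.adicCompletion K) ((p ^ 1 : ℕ) : ℤ) z =
            a • (W.baseChange K).torsionLocMap (v.adicCompletion K) ((p ^ 1 : ℕ) : ℤ) y) →
          (W.baseChange K).torsionLocMap (v.adicCompletion K) ((p ^ 1 : ℕ) : ℤ) z = 0) ∧
      -- (Iso)
      (∀ (n : Finset (AdmQ W K p)) (q : AdmQ W K p) (μ : Bool),
        q ∉ n → ∀ v : HeightOneSpectrum (𝓞 K), ((q : ℕ) : 𝓞 K) ∈ v.asIdeal →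
        ∀ y ∈ SelRelQP W K p c (insert q n) {q} μ, ∀ z ∈ SelRelQP W K p c (insert q n) {q} μ,
          (W.baseChange K).torsionLocMap (v.adicCompletion K) ((p ^ 1 : ℕ) : ℤ) z ≠ 0 →
          ∃ a : ℤ, (W.baseChange K).torsionLocMap (v.adicCompletion K) ((p ^ 1 : ℕ) : ℤ) y =
            a • (W.baseChange K).torsionLocMap (v.adicCompletion K) ((p ^ 1 : ℕ) : ℤ) z)) :
    ∀ (W : WeierstrassCurve ℚ) [W.IsElliptic] [W.IsGloballyMinimal] [NeZero (W.conductorNorm ℤ)]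
      (p : ℕ) [Fact p.Prime] (K : Type) [Field K] [NumberField K]
      (Dt : ModularParametrizationData W (W.conductorNorm ℤ)) (β : ℤ) (ι : K →+* ℂ),
      5 ≤ p → Addv W p → W.HasSurjectiveModNGaloisRep p →
      (∀ (ℓ : ℕ) [Fact ℓ.Prime], W.HasMultiplicativeReductionAtPrime ℓ →
        ¬ p ∣ padicValInt ℓ W.minimalDiscriminantInt) →
      (∃ (ℓ₁ ℓ₂ : ℕ) (_ : Fact ℓ₁.Prime) (_ : Fact ℓ₂.Prime), ℓ₁ ≠ ℓ₂ ∧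
        W.HasMultiplicativeReductionAtPrime ℓ₁ ∧ W.HasMultiplicativeReductionAtPrime ℓ₂) →
      ¬ p ∣ W.tamagawaProduct → W.analyticRank = 1 →
      IsImaginaryQuadratic K → Odd (NumberField.discr K) →
      SatisfiesHeegnerHypothesis (W.conductorNorm ℤ) K →
      (W.quadraticTwist (NumberField.discr K : ℚ)).entireLFunction 1 ≠ 0 →
      (4 * (W.conductorNorm ℤ : ℤ)) ∣ β ^ 2 - NumberField.discr K → ¬ (p : ℤ) ∣ Dt.c →
      ∀ (c : K ≃ₐ[ℚ] K), c ≠ 1 → ∀ [Module (ZMod p) (Vp W K p)],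
        (∀ (n : Finset (AdmQ W K p)) (μ : Bool) (x : Vp W K p),
          x ∈ SelQP W K p c n μ → x ≠ 0 →
          ∃ q : AdmQ W K p, q ∉ n ∧
            x ∉ SelQP W K p c (insert q n) μ ∧
            SelQP W K p c (insert q n) μ ≤ SelQP W K p c n μ ∧
            finrank (ZMod p) (SelQP W K p c (insert q n) μ) + 1 = finrank (ZMod p) (SelQP W K p c n μ) ∧
            SelQP W K p c (insert q n) (!μ) = SelQP W K p c n (!μ)) := by
  intro W _ _ _ p _ K _ _ Dt β ι h5 _ hsurj _ _ _ _ hK _ _ _ _ _ c hc1 _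
  have hp : Odd p := (Fact.out : p.Prime).odd_of_ne_two (by omega)
  obtain ⟨hcheb, hequiv, hline, htrans, hiso⟩ := hLG W p K c h5 hsurj hK hc1
  exact selQP_rankLowering_of_localGlobal W K p c hp hcheb hequiv hline htrans hiso

end Stub

end Summit.BirchSwinnertonDyer.BirchSwinnertonDyer.Theorems.AdditiveKoly

end
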